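import Summits.QuantumFields.YangMills.Theorems.BalabanUVNodesN15CovariantAveragingObjects
import Summits.QuantumFields.YangMills.Theorems.BalabanUVNodesN15TwoGridEntry0
import Mathlib.LinearAlgebra.Matrix.Kronecker
import HarnessLib

/-!
# Route «BalabanUVNodes», node N15 = NE2, road (c) — PROGRAMME (P-R), I: THE OBJECTS OF BAŁABAN's LANDAU SUMMAND `D_U R(U) D*_U` OF (3.26) IN THE MODEL —
# the covariant gradient `D_U` of coloured scalar (gauge-parameter) fields, the covariant scalar block averaging `Q′(U)` of (3.19), the operator
# `Δ′_a(U) = Δ^U + Q′*(U)aQ′(U)` of (3.24), its inverse `G′(U)`, the projection `I − R(U) = G′Q′*(Q′G′²Q′*)⁻¹Q′G′` of (3.25), `R(U)`, and the covariant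
# Landau term `D_U (I − R(U)) D*_U`; at `U ≡ 1` every object is its flat letter `⊗ₖ 1_ι` (dag-n15-c g22, n15-c∕197)

Cell `pub-ymgap`, seat `pub-ymgap-dag-n15-c` (generation g22; R134 (a) seat, strategy s1; HUMAN RULING D-0062; chair R424 venue).  `bears_on: R4∕N15 · K3⁸
SpineGivenEndpointR13SepCoPHV (stmt-QuantumFields-27366)`; filed `--supports stmt-QuantumFields-27366 --as helper` — COUNT-NEUTRAL.  Plumbing `def`s + finite
matrix algebra ([folklore]); 0 `sorry`, no `Prop`-valued definition, NO estimate.  Imports BY NAME, nothing in the tree modified ∕ restated: this seat's n15-c∕181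
`…N15CovariantAveragingObjects` (`cvaStair`, `cvaStair_one` — the staircase transport of (125)), dag-n15-a part 46 `…N15TwoGridEntry0` (`landauRe` = the FLAT Landau
term `∂Π∂*` of (1.69), for the docstring pointer and the sequel n15-c∕200), Mathlib's `Matrix.kroneckerMap` (`⊗ₖ`, `mul_kronecker_mul`, `inv_kronecker`); through
them b05's `GradOp`∕`sdiff`∕`shiftS` ((1.4)), `QsOp`∕`bpt` ((1.20)), `reM`, King's `blockOf`, the lane's `blockCoords`∕`kingBlockOf_bpt`.

WHY (the lane's LOCATED object after PROGRAMME (P-Q), HOME HANDOFF g21; the director's N15 rider «+1 located burden: non-abelian G(U) dressing of NE2»).  Every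
`NE2PlusOperator` certificate of this road (FILES 129–196) dresses Bałaban's principal part `Δ_{R_U}` ((3.50)) with the summand `P`; after n15-c∕181–196 the AVERAGING
summand `a·Q*(U)Q(U)` of `P(U) = Q*(U)aQ(U) + D_U R(U) D*_U` ([Balaban1985BackgroundPropagators] (3.26) p. 395) is covariant and live, while the LANDAU summand is
still the flat `−∂Π∂* ⊗ 1_ι` ([Balaban1984PropagatorsI] (1.69); n15-a part 46 `landauRe`).  The print (p. 394–395): *«R = R(U) is an orthogonal projection in the
Hilbert space L²(Ω₀, g) onto the subspace ℛ = Δ^η_U N(Q′), N(Q′) = {λ : Q′λ = 0} (3.21) … Δ^η_U = D^{η*}_U D^η_U (3.23) … Δ′_a = Δ′_a(U) = (Δ^η_U + Q′*aQ′)|_{Ω₀}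
(3.24) … Rf = (I − G′Q′*(Q′G′²Q′*)⁻¹Q′G′)f, (3.25) where G′ = G′(U) = (Δ′_a)⁻¹ … We define Δ_a(U) = Δ(U) + D_U R(U) D*_U + Q*(U)aQ(U), (3.26) … It coincides
with Δ_a in (2.19) if U = 1.»*  THIS FILE types these objects on the lane's carriers — coloured scalar fields `(Tor (fine n M) × ι → ℝ)` (the gauge parameters
`λ : T_η → 𝔤` in trace-form coordinates), coloured 1-forms `((Tor (fine n M) × Fin (d+1)) × ι → ℝ)`, coarse scalars `(Tor M × ι → ℝ)` — as REAL MATRICES (so that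
`G′ = (Δ′_a)⁻¹` and `(Q′G′²Q′*)⁻¹` are Mathlib's `Matrix.inv`), with the one-bond transporters a SITE datum `T : Fin (d+1) → Tor (fine n M) → Matrix ι ι ℝ` (the
sequel instantiates `T μ x = coordMat e Ad_{U(x, x+ηe_μ)}`; `T ≡ 1` at `U ≡ 1`), and proves the `U ≡ 1` DICTIONARY: every object is its flat scalar letter
Kronecker-tensored with `1_ι` — the first half of «it coincides with Δ_a in (2.19) if U = 1» (the second half, `landauFlat = reM(∂·Π·∂ᴴ)` with b05's `PcT`, i.e.
`landauCov 1 = landauRe ⊗ 1_ι`, is n15-c∕200).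

OBJECTS AND RESULTS ([folklore] unless tagged; equation tags mark which printed formula an object transcribes — nothing printed is asserted).
* §1 ★ `cgrad T` — `(D_T λ)((x, ν), i) = n·(Σ_j T_ν(x)_{ij} λ(x + e_ν, j) − λ(x, i))` ((3.23)∕(3.50) shape: the far endpoint transported back to `x`); `cgrad_mulVec`;
  ★ `csavg T` — `(Q′_T λ)(y, i) = n^{−(d+1)} Σ_{x ∈ B(y)} Σ_j (T(Γ_{y,x}))_{ij} λ(x, j)` ((3.19) shape, staircase transport `cvaStair` of n15-c∕181); `csavg_mulVec`.
* §2 `claplA T a := (cgrad T)ᵀ·cgrad T + a·(csavg T)ᵀ·csavg T` ((3.24) `Δ′_a(U)`, model weights), `cGreen T a := (claplA T a)⁻¹` ((3.25) `G′(U)`), `cSop T a :=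
  csavg·cGreen²·csavgᵀ` (`Q′G′²Q′*`), ★ `cPi T a := cGreen·csavgᵀ·cSop⁻¹·csavg·cGreen` (`I − R(U)` of (3.25)), `cR T a := 1 − cPi T a` (`R(U)`), ★★ **`landauCov T a :=
  cgrad·cPi·cgradᵀ`** (`D_U (I − R(U)) D*_U`: the covariant twin of the flat `∂Π∂*`; Bałaban's summand is `D_U R(U) D*_U = D_U D*_U − landauCov`).
* §3 the flat letters: `gradFlat := reM (GradOp (fine n M) n)`, `qsFlat := reM (QsOp n M)` (+ `QsOp_eq_ite`: b05's block sum IS the indicator of `B(y)`), `lapAFlat`,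
  `greenFlat`, `sopFlat`, `piFlat`, ★ `landauFlat := gradFlat·piFlat·gradFlatᵀ`.
* §4 THE `U ≡ 1` DICTIONARY: ★ `cgrad_one : cgrad 1 = gradFlat ⊗ₖ 1`, ★ `csavg_one : csavg 1 = qsFlat ⊗ₖ 1`, `claplA_one`, `cGreen_one`, `cSop_one`, `cPi_one`, `cR_one`,
  ★★ **`landauCov_one : landauCov 1 a = landauFlat a ⊗ₖ 1`**.

HONEST FRAMING ∕ LIMITS.  Definitions + finite matrix algebra; NO estimate, no positivity claim (invertibility of `Δ′_a(U)` and of `Q′G′²Q′*` — p. 395 l. 1–3 —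
is the sequel n15-c∕199; until then `cGreen`, `cSop⁻¹` are Mathlib's total `Matrix.inv`).  MODEL READING: ONE averaging level on the whole torus (no Dirichlet
domains `Ω_j` of (3.24), `Ω₀ = T_η` as in [Balaban1985RegularSpaces] p. 77), uniform weights (the `(L^jη)^{d−2}`∕`η^d` weights of (3.11)∕(3.24) dropped — the
projection `I − R` is weight-blind, `G′` is not), one-level staircase contours `Γ_{y,x}` of n15-c∕181 (not the multi-level contours (3.55)), site (component-blind)
transporters.  The print's `R(U)`, `Δ_a(U)` are typed on OTHER carriers elsewhere in the tree (Hilbert-space `starProjection`: `B9Eq321LandauProjectionZdPer.projEPer`,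
`B11Eq103H1Complex.RLatticeK`, `B9Eq326OperatorAssembly.laplaceAofU`; flat dictionary `B9Eq321FlatProjectionDictionary`) — cited, not restated, not bridged here.
The short names live in the closed namespace `…N15.CovLandau`: NOT GAN24's `landauCov` (`Summits/QuantumFields/BalabanUV/Beta/GAN24/WoodburyFibreLandauLimit`) nor NE7's
`cGreen` (`T4Continuum/Support/NE7StraightSliceB5Green`) — unrelated objects (dag-lead DEDUP WORDS 59).
NOT [Balaban1985BackgroundPropagators] Thms 3.1–3.3; NE2⁺ NOT PRINTED; N15 of record untouched (DISCHARGED AS CONSUMED, p687738); counts UNMOVED (typed 28∕28);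
one finite 𝕋⁴ at fixed ε per index — NOT infinite volume ∕ OS ∕ mass gap ∕ Clay.  Restate-immune (no Theses import).
-/

noncomputable section

open scoped BigOperators Matrix Kronecker
open Finset

namespace Summit.QuantumFields.YangMills.BalabanUVNodes.N15.CovLandau

open Literature.MathematicalPhysics.QuantumFieldTheory.Balaban1983to89
open Literature.MathematicalPhysics.QuantumFieldTheory.Balaban1983to89.B5Prop11Plancherel (Tor fine unitVec)
open Literature.MathematicalPhysics.QuantumFieldTheory.Balaban1983to89.B5Block118 (bpt QsOp)
open Literature.MathematicalPhysics.QuantumFieldTheory.Balaban1983to89.B5Action121 (GradOp sdiff shiftS)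
open Literature.MathematicalPhysics.QuantumFieldTheory.Balaban1983to89.B5RealFields (reM reM_apply)
open Literature.MathematicalPhysics.QuantumFieldTheory.Balaban1983to89.B5Blocks16 (bpt_injective)
open Literature.MathematicalPhysics.QuantumFieldTheory.King1986.Torus (blockOf)
open Summit.QuantumFields.YangMills.BalabanUVNodes.N15.VectorPiece (blockCoords blockCoords_bpt bpt_blockCoords)
open Summit.QuantumFields.YangMills.BalabanUVNodes.N15.DefectKernel (kingBlockOf_bpt)
open Summit.QuantumFields.YangMills.BalabanUVNodes.N15.CovAvg (cvaStair cvaStair_one)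

variable {d : ℕ}

/-! ## §1 The covariant gradient of coloured scalar fields and the covariant scalar block averaging `Q′(U)` -/

section Objects

variable (M : Fin (d + 1) → ℕ) [∀ μ, NeZero (M μ)] (n : ℕ) [NeZero n] {ι : Type} [Fintype ι] [DecidableEq ι]

/-- ★ **THE COVARIANT GRADIENT `D_U` OF COLOURED SCALAR FIELDS** (gauge parameters `λ : T_η → 𝔤` in trace-form coordinates), as a real matrix from scalars
`Tor (fine n M) × ι` to 1-forms `(Tor (fine n M) × Fin (d+1)) × ι`: `(D_T λ)((x, ν), i) = n·(Σ_j T_ν(x)_{ij}·λ(x + e_ν, j) − λ(x, i))` — the value at the far endpoint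
of the bond transported back to `x` by the one-bond transporter `T_ν(x)` (`= coordMat e Ad_{U(x, x+ηe_ν)}` in the sequel; `T ≡ 1` at `U ≡ 1` gives b05's `∂ ⊗ 1_ι`).
[cite: Balaban1985BackgroundPropagators, (3.23) p.394, (3.50) p.400 (shape)] -/
def cgrad (T : Fin (d + 1) → Tor (fine n M) → Matrix ι ι ℝ) : Matrix ((Tor (fine n M) × Fin (d + 1)) × ι) (Tor (fine n M) × ι) ℝ :=
  fun p q => (n : ℝ) * ((if q.1 = p.1.1 + unitVec (fine n M) p.1.2 then T p.1.2 p.1.1 p.2 q.2 else 0) - (if p.1.1 = q.1 then (1 : Matrix ι ι ℝ) p.2 q.2 else 0))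

/-- Pointwise action of `D_T`. [folklore] -/
theorem cgrad_mulVec (T : Fin (d + 1) → Tor (fine n M) → Matrix ι ι ℝ) (lam : Tor (fine n M) × ι → ℝ) (x : Tor (fine n M)) (ν : Fin (d + 1)) (i : ι) :
    (cgrad M n T *ᵥ lam) ((x, ν), i) = (n : ℝ) * (∑ j, T ν x i j * lam (x + unitVec (fine n M) ν, j) - lam (x, i)) := by
  simp only [Matrix.mulVec, dotProduct, cgrad]
  rw [Fintype.sum_prod_type]
  simp only [mul_sub, sub_mul, Finset.sum_sub_distrib]
  congr 1
  · rw [Finset.mul_sum]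
    rw [Finset.sum_eq_single (x + unitVec (fine n M) ν) (fun y _ hy => by simp [hy]) (fun h => (h (Finset.mem_univ _)).elim)]
    simp only [if_true]
    exact Finset.sum_congr rfl fun j _ => by ring
  · rw [Finset.sum_eq_single x (fun y _ hy => by simp [Ne.symm hy]) (fun h => (h (Finset.mem_univ _)).elim)]
    simp only [if_true, Matrix.one_apply, mul_ite, mul_one, mul_zero, ite_mul, zero_mul, Finset.sum_ite_eq, Finset.mem_univ]

/-- ★ **THE COVARIANT SCALAR BLOCK AVERAGING `Q′(U)`** as a real matrix from fine scalars `Tor (fine n M) × ι` to coarse scalars `Tor M × ι`: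
`(Q′_T λ)(y, i) = n^{−(d+1)} Σ_{x ∈ B(y)} Σ_j (T(Γ_{y,x}))_{ij}·λ(x, j)` — every value transported to the base point of its block along the staircase `Γ_{y,x}` (n15-c∕181's
`cvaStair` at the site datum; `T ≡ 1` gives b05's `Q′ ⊗ 1_ι`). [cite: Balaban1985BackgroundPropagators, (3.19) p.393 (shape); Balaban1984PropagatorsI, (1.20) p.20] -/
def csavg (T : Fin (d + 1) → Tor (fine n M) → Matrix ι ι ℝ) : Matrix (Tor M × ι) (Tor (fine n M) × ι) ℝ :=
  fun q p => if blockOf n M p.1 = q.1 then ((n : ℝ) ^ (d + 1))⁻¹ * cvaStair M n (fun μ b => T μ b.1) q.1 (blockCoords n M p.1).2 0 q.2 p.2 else 0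

/-- Pointwise action of `Q′_T`: a sum over the block of `y` in block coordinates. [folklore] -/
theorem csavg_mulVec (T : Fin (d + 1) → Tor (fine n M) → Matrix ι ι ℝ) (lam : Tor (fine n M) × ι → ℝ) (y : Tor M) (i : ι) :
    (csavg M n T *ᵥ lam) (y, i) = ((n : ℝ) ^ (d + 1))⁻¹ * ∑ a : Fin (d + 1) → Fin n, ∑ j, cvaStair M n (fun μ b => T μ b.1) y a 0 i j * lam (bpt n M y a, j) := by
  simp only [Matrix.mulVec, dotProduct, csavg]
  rw [Fintype.sum_prod_type, Finset.mul_sum]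
  -- reparametrise the fine sites by block coordinates
  rw [← (Equiv.ofBijective _ (B5Blocks16.bpt_bijective n M)).sum_comp, Fintype.sum_prod_type]
  simp only [Equiv.ofBijective_apply, kingBlockOf_bpt, blockCoords_bpt, ite_mul, zero_mul]
  rw [Finset.sum_eq_single y (fun y' _ hy' => by simp [hy']) (fun h => (h (Finset.mem_univ _)).elim)]
  simp only [if_true, Finset.mul_sum]
  exact Finset.sum_congr rfl fun a _ => Finset.sum_congr rfl fun j _ => by ring

end Objects

/-! ## §2 `Δ′_a(U)`, `G′(U)`, `Q′G′²Q′*`, the projection `I − R(U)`, `R(U)`, and the covariant Landau term -/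

section Composite

variable (M : Fin (d + 1) → ℕ) [∀ μ, NeZero (M μ)] (n : ℕ) [NeZero n] {ι : Type} [Fintype ι] [DecidableEq ι]

/-- `Δ′_a(U) = Δ^U + Q′*(U)aQ′(U)` with `Δ^U = D*_U D_U` (model weights: plain transposes). [cite: Balaban1985BackgroundPropagators, (3.23)–(3.24) p.394 (shape)] -/
def claplA (T : Fin (d + 1) → Tor (fine n M) → Matrix ι ι ℝ) (a : ℝ) : Matrix (Tor (fine n M) × ι) (Tor (fine n M) × ι) ℝ :=
  (cgrad M n T)ᵀ * cgrad M n T + a • ((csavg M n T)ᵀ * csavg M n T)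

/-- `G′(U) = (Δ′_a(U))⁻¹` (Mathlib's total inverse; a genuine two-sided inverse once `Δ′_a(U)` is invertible — the sequel). [cite: Balaban1985BackgroundPropagators, (3.25) p.394 («G′ = G′(U) = (Δ′_a)⁻¹»: shape)] -/
def cGreen (T : Fin (d + 1) → Tor (fine n M) → Matrix ι ι ℝ) (a : ℝ) : Matrix (Tor (fine n M) × ι) (Tor (fine n M) × ι) ℝ :=
  (claplA M n T a)⁻¹

/-- `Q′G′²Q′*` on the coarse scalars. [cite: Balaban1985BackgroundPropagators, (3.25) p.394 (shape)] -/
def cSop (T : Fin (d + 1) → Tor (fine n M) → Matrix ι ι ℝ) (a : ℝ) : Matrix (Tor M × ι) (Tor M × ι) ℝ :=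
  csavg M n T * (cGreen M n T a * cGreen M n T a) * (csavg M n T)ᵀ

/-- ★ `I − R(U) = G′Q′*(Q′G′²Q′*)⁻¹Q′G′` — the orthogonal projection complementary to Bałaban's `R(U)`. [cite: Balaban1985BackgroundPropagators, (3.25) p.394 (shape)] -/
def cPi (T : Fin (d + 1) → Tor (fine n M) → Matrix ι ι ℝ) (a : ℝ) : Matrix (Tor (fine n M) × ι) (Tor (fine n M) × ι) ℝ :=
  cGreen M n T a * (csavg M n T)ᵀ * (cSop M n T a)⁻¹ * csavg M n T * cGreen M n T a

/-- `R(U) = I − G′Q′*(Q′G′²Q′*)⁻¹Q′G′`. [cite: Balaban1985BackgroundPropagators, (3.21) p.394, (3.25) p.394 (shape)] -/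
def cR (T : Fin (d + 1) → Tor (fine n M) → Matrix ι ι ℝ) (a : ℝ) : Matrix (Tor (fine n M) × ι) (Tor (fine n M) × ι) ℝ :=
  1 - cPi M n T a

/-- ★★ **THE COVARIANT LANDAU TERM `D_U (I − R(U)) D*_U`** on coloured 1-forms — the covariant twin of the flat `∂Π∂*` of [Balaban1984PropagatorsI] (1.69) (n15-a part 46
`landauRe`); Bałaban's summand of (3.26) is `D_U R(U) D*_U = D_U D*_U − landauCov`. [cite: Balaban1985BackgroundPropagators, (3.26) p.395 (shape); Balaban1984PropagatorsI, (1.69) p.29] -/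
def landauCov (T : Fin (d + 1) → Tor (fine n M) → Matrix ι ι ℝ) (a : ℝ) : Matrix ((Tor (fine n M) × Fin (d + 1)) × ι) ((Tor (fine n M) × Fin (d + 1)) × ι) ℝ :=
  cgrad M n T * cPi M n T a * (cgrad M n T)ᵀ

end Composite

/-! ## §3 The flat letters -/

section Flat

variable (M : Fin (d + 1) → ℕ) [∀ μ, NeZero (M μ)] (n : ℕ) [NeZero n]

/-- The flat scalar gradient `∂` of (1.4) on real scalar fields (real part of b05's `GradOp`). [cite: Balaban1984PropagatorsI, (1.4) p.18] -/
def gradFlat : Matrix (Tor (fine n M) × Fin (d + 1)) (Tor (fine n M)) ℝ := reM (GradOp (fine n M) (n : ℂ))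

/-- The flat scalar block averaging `Q′` of (1.20) on real scalar fields (real part of b05's `QsOp`). [cite: Balaban1984PropagatorsI, (1.20) p.20] -/
def qsFlat : Matrix (Tor M) (Tor (fine n M)) ℝ := reM (QsOp n M)

/-- The flat `Δ′_a = ∂ᵀ∂ + a·Q′ᵀQ′`. [cite: Balaban1985BackgroundPropagators, (3.24) p.394 (at `U ≡ 1`, model weights)] -/
def lapAFlat (a : ℝ) : Matrix (Tor (fine n M)) (Tor (fine n M)) ℝ := (gradFlat M n)ᵀ * gradFlat M n + a • ((qsFlat M n)ᵀ * qsFlat M n)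

/-- The flat `G′ = (Δ′_a)⁻¹`. [cite: Balaban1985BackgroundPropagators, (3.25) p.394 (at `U ≡ 1`)] -/
def greenFlat (a : ℝ) : Matrix (Tor (fine n M)) (Tor (fine n M)) ℝ := (lapAFlat M n a)⁻¹

/-- The flat `Q′G′²Q′ᵀ`. [cite: Balaban1985BackgroundPropagators, (3.25) p.394 (at `U ≡ 1`)] -/
def sopFlat (a : ℝ) : Matrix (Tor M) (Tor M) ℝ := qsFlat M n * (greenFlat M n a * greenFlat M n a) * (qsFlat M n)ᵀ

/-- The flat `I − R(1) = G′Q′ᵀ(Q′G′²Q′ᵀ)⁻¹Q′G′`. [cite: Balaban1985BackgroundPropagators, (3.25) p.394 (at `U ≡ 1`)] -/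
def piFlat (a : ℝ) : Matrix (Tor (fine n M)) (Tor (fine n M)) ℝ :=
  greenFlat M n a * (qsFlat M n)ᵀ * (sopFlat M n a)⁻¹ * qsFlat M n * greenFlat M n a

/-- ★ The flat `∂(I − R(1))∂ᵀ` (equal to b05's `reM (∂·PcT·∂ᴴ)` — the sequel n15-c∕200). [cite: Balaban1985BackgroundPropagators, (3.26) p.395 («coincides with Δ_a in (2.19) if U = 1»)] -/
def landauFlat (a : ℝ) : Matrix (Tor (fine n M) × Fin (d + 1)) (Tor (fine n M) × Fin (d + 1)) ℝ := gradFlat M n * piFlat M n a * (gradFlat M n)ᵀ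

/-- b05's block sum counted out: `Q′(y, x) = n^{−(d+1)}·𝟙[x ∈ B(y)]`. [cite: Balaban1984PropagatorsI, (1.20) p.20] -/
theorem QsOp_eq_ite (y : Tor M) (x : Tor (fine n M)) : QsOp n M y x = if blockOf n M x = y then 1 / (n : ℂ) ^ (d + 1) else 0 := by
  have hx : x = bpt n M (blockCoords n M x).1 (blockCoords n M x).2 := (bpt_blockCoords n M x).symm
  have hinj : ∀ a : Fin (d + 1) → Fin n, (x = bpt n M y a) ↔ ((blockCoords n M x).1 = y ∧ (blockCoords n M x).2 = a) := by
    intro a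
    constructor
    · intro h
      have h' := bpt_injective n M (a₁ := ((blockCoords n M x).1, (blockCoords n M x).2)) (a₂ := (y, a)) (by simpa using hx.symm.trans h)
      exact ⟨congrArg Prod.fst h', congrArg Prod.snd h'⟩
    · rintro ⟨h1, h2⟩
      rw [hx, h1, h2]
  have hblk : blockOf n M x = (blockCoords n M x).1 := by
    conv_lhs => rw [hx]
    simp only [kingBlockOf_bpt]
  unfold QsOp
  simp_rw [hinj]
  rw [hblk]
  by_cases hy : (blockCoords n M x).1 = y
  · simp only [hy, true_and, if_true, Finset.sum_ite_eq, Finset.mem_univ]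
  · simp only [hy, false_and, if_false, Finset.sum_const_zero]

/-- Entries of the flat block averaging. [folklore] -/
theorem qsFlat_apply (y : Tor M) (x : Tor (fine n M)) : qsFlat M n y x = if blockOf n M x = y then ((n : ℝ) ^ (d + 1))⁻¹ else 0 := by
  rw [qsFlat, reM_apply, QsOp_eq_ite]
  split_ifs
  · rw [show (1 / (n : ℂ) ^ (d + 1)) = ((((n : ℝ) ^ (d + 1))⁻¹ : ℝ) : ℂ) by push_cast; rw [one_div], Complex.ofReal_re]
  · rfl

omit [∀ μ, NeZero (M μ)] [NeZero n] in
/-- Entries of the flat gradient. [folklore] -/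
theorem gradFlat_apply (p : Tor (fine n M) × Fin (d + 1)) (y : Tor (fine n M)) :
    gradFlat M n p y = (n : ℝ) * ((if y = p.1 + unitVec (fine n M) p.2 then 1 else 0) - (if p.1 = y then 1 else 0)) := by
  rw [gradFlat, reM_apply]
  simp only [B5Action121.GradOp, B5Action121.sdiff, B5Action121.shiftS, Matrix.smul_apply, Matrix.sub_apply, Matrix.one_apply, smul_eq_mul]
  split_ifs <;> simp

end Flat

/-! ## §4 The `U ≡ 1` dictionary: every object is its flat letter `⊗ₖ 1_ι` -/

section One

variable (M : Fin (d + 1) → ℕ) [∀ μ, NeZero (M μ)] (n : ℕ) [NeZero n] (ι : Type) [Fintype ι] [DecidableEq ι]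

omit [∀ μ, NeZero (M μ)] [Fintype ι] [NeZero n] in
/-- ★ At `U ≡ 1` the covariant gradient is `∂ ⊗ₖ 1_ι`. [cite: Balaban1984PropagatorsI, (1.4) p.18] -/
theorem cgrad_one : cgrad M n (fun (_ : Fin (d + 1)) (_ : Tor (fine n M)) => (1 : Matrix ι ι ℝ)) = gradFlat M n ⊗ₖ (1 : Matrix ι ι ℝ) := by
  ext ⟨⟨x, ν⟩, i⟩ ⟨y, j⟩
  rw [Matrix.kroneckerMap_apply, gradFlat_apply]
  simp only [cgrad]
  split_ifs <;> ring

/-- ★ At `U ≡ 1` the covariant block averaging is `Q′ ⊗ₖ 1_ι`. [cite: Balaban1984PropagatorsI, (1.20) p.20] -/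
theorem csavg_one : csavg M n (fun (_ : Fin (d + 1)) (_ : Tor (fine n M)) => (1 : Matrix ι ι ℝ)) = qsFlat M n ⊗ₖ (1 : Matrix ι ι ℝ) := by
  ext ⟨y, i⟩ ⟨x, j⟩
  rw [Matrix.kroneckerMap_apply, qsFlat_apply]
  simp only [csavg]
  have h1 : cvaStair M n (fun (μ : Fin (d + 1)) (b : Tor (fine n M) × Fin (d + 1)) => (1 : Matrix ι ι ℝ)) y (blockCoords n M x).2 0 = 1 := cvaStair_one M n _ _ _
  rw [h1]
  split_ifs <;> simp

/-- At `U ≡ 1`: `Δ′_a(1) = Δ′_a^{flat} ⊗ₖ 1_ι`. [cite: Balaban1985BackgroundPropagators, (3.24) p.394] -/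
theorem claplA_one (a : ℝ) : claplA M n (fun (_ : Fin (d + 1)) (_ : Tor (fine n M)) => (1 : Matrix ι ι ℝ)) a = lapAFlat M n a ⊗ₖ (1 : Matrix ι ι ℝ) := by
  rw [claplA, cgrad_one, csavg_one, ← Matrix.kroneckerMap_transpose, ← Matrix.kroneckerMap_transpose, Matrix.transpose_one, ← Matrix.mul_kronecker_mul,
    ← Matrix.mul_kronecker_mul, Matrix.mul_one, ← Matrix.smul_kronecker, ← Matrix.add_kronecker, lapAFlat]

/-- At `U ≡ 1`: `G′(1) = G′^{flat} ⊗ₖ 1_ι`. [cite: Balaban1985BackgroundPropagators, (3.25) p.394] -/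
theorem cGreen_one (a : ℝ) : cGreen M n (fun (_ : Fin (d + 1)) (_ : Tor (fine n M)) => (1 : Matrix ι ι ℝ)) a = greenFlat M n a ⊗ₖ (1 : Matrix ι ι ℝ) := by
  rw [cGreen, claplA_one, Matrix.inv_kronecker, inv_one, greenFlat]

/-- At `U ≡ 1`: `Q′G′²Q′* = (Q′G′²Q′ᵀ)^{flat} ⊗ₖ 1_ι`. [cite: Balaban1985BackgroundPropagators, (3.25) p.394] -/
theorem cSop_one (a : ℝ) : cSop M n (fun (_ : Fin (d + 1)) (_ : Tor (fine n M)) => (1 : Matrix ι ι ℝ)) a = sopFlat M n a ⊗ₖ (1 : Matrix ι ι ℝ) := by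
  rw [cSop, cGreen_one, csavg_one, ← Matrix.kroneckerMap_transpose, Matrix.transpose_one, ← Matrix.mul_kronecker_mul, Matrix.mul_one,
    ← Matrix.mul_kronecker_mul, Matrix.mul_one, ← Matrix.mul_kronecker_mul, Matrix.mul_one, sopFlat]

/-- ★ At `U ≡ 1`: `I − R(1) = (I − R(1))^{flat} ⊗ₖ 1_ι`. [cite: Balaban1985BackgroundPropagators, (3.25) p.394] -/
theorem cPi_one (a : ℝ) : cPi M n (fun (_ : Fin (d + 1)) (_ : Tor (fine n M)) => (1 : Matrix ι ι ℝ)) a = piFlat M n a ⊗ₖ (1 : Matrix ι ι ℝ) := by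
  rw [cPi, cGreen_one, csavg_one, cSop_one, Matrix.inv_kronecker, inv_one, ← Matrix.kroneckerMap_transpose, Matrix.transpose_one,
    ← Matrix.mul_kronecker_mul, Matrix.mul_one, ← Matrix.mul_kronecker_mul, Matrix.mul_one, ← Matrix.mul_kronecker_mul, Matrix.mul_one,
    ← Matrix.mul_kronecker_mul, Matrix.mul_one, piFlat]

omit [∀ μ, NeZero (M μ)] [NeZero n] [DecidableEq ι] in
/-- Kronecker products distribute over differences on the left. [folklore] -/
theorem sub_kronecker {l m p q : Type} (A₁ A₂ : Matrix l m ℝ) (B : Matrix p q ℝ) : (A₁ - A₂) ⊗ₖ B = A₁ ⊗ₖ B - A₂ ⊗ₖ B := by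
  ext ⟨i, i'⟩ ⟨j, j'⟩
  simp [Matrix.kroneckerMap_apply, sub_mul]

/-- At `U ≡ 1`: `R(1) = R(1)^{flat} ⊗ₖ 1_ι`. [cite: Balaban1985BackgroundPropagators, (3.21) p.394, (3.25) p.394] -/
theorem cR_one (a : ℝ) : cR M n (fun (_ : Fin (d + 1)) (_ : Tor (fine n M)) => (1 : Matrix ι ι ℝ)) a = (1 - piFlat M n a) ⊗ₖ (1 : Matrix ι ι ℝ) := by
  rw [cR, cPi_one, sub_kronecker, Matrix.one_kronecker_one]

/-- ★★ **AT `U ≡ 1` THE COVARIANT LANDAU TERM IS THE FLAT ONE `⊗ₖ 1_ι`**: `landauCov 1 a = landauFlat a ⊗ₖ 1_ι`. [cite: Balaban1985BackgroundPropagators, (3.26) p.395 («It coincides with Δ_a in (2.19) if U = 1»)] -/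
theorem landauCov_one (a : ℝ) : landauCov M n (fun (_ : Fin (d + 1)) (_ : Tor (fine n M)) => (1 : Matrix ι ι ℝ)) a = landauFlat M n a ⊗ₖ (1 : Matrix ι ι ℝ) := by
  rw [landauCov, cPi_one, cgrad_one, ← Matrix.kroneckerMap_transpose, Matrix.transpose_one, ← Matrix.mul_kronecker_mul, Matrix.mul_one,
    ← Matrix.mul_kronecker_mul, Matrix.mul_one, landauFlat]

end One

end Summit.QuantumFields.YangMills.BalabanUVNodes.N15.CovLandau

end
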